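import Mathlib
import Summits.Ventures.PercRepro2.HCov

/-!
# The one-edge cubic of (HCOV): the Bernstein coefficients `B1`, `B2` of `Gc` along an edge
(blind cell PercRepro2, p5 g14; `proofs/P5-OEDGE.md` §2)

Along any edge `e` with `t = p e`, every pattern mass of `Gc` is affine in `t` (`prob_eq_pin`), so
`Gc` is a cubic in `t`; in the Bernstein basis (**`Gc_pin_cubic`**)

  `Gc p = (1 − t)³·Gc p[e↦0] + t(1 − t)²·B1 + t²(1 − t)·B2 + t³·Gc p[e↦1]`

with `B1`, `B2` the POLARISED cubic form — each monomial `x·y·z` of `Gc` (`GcPoly`) replaced by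
`polar1 = x₁y₀z₀ + x₀y₁z₀ + x₀y₀z₁` (one copy at `p[e↦1]`) resp. `polar2 = x₁y₁z₀ + x₁y₀z₁ + x₀y₁z₁`
(two copies); `B1 = 3b₁`, `B2 = 3b₂` for the Bernstein coefficients `b_k` of row 2′CPOLAR (no division
by `3`, so the identity holds over every field).  **`HCov_of_update_zero_of_bern`**: (HCOV) at
`p[e↦0]` and at `p[e↦1]` together with `0 ≤ B1`, `0 ≤ B2` give (HCOV) at `p` (the Bernstein basis is
nonnegative on `[0, 1]`) — the closure principle of row 2′CPOLAR at one edge, in the tree's vocabulary.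
-/

namespace Summit.Ventures.PercRepro2

open UnionCluster

namespace CovForm

namespace EdgeLine

section Polar

variable {R : Type*} [Field R]

/-- The one-copy polarisation of a monomial `x·y·z`: `x₁y₀z₀ + x₀y₁z₀ + x₀y₀z₁`. -/
def polar1 (x₀ x₁ y₀ y₁ z₀ z₁ : R) : R := x₁ * y₀ * z₀ + x₀ * y₁ * z₀ + x₀ * y₀ * z₁

/-- The two-copy polarisation of a monomial `x·y·z`: `x₁y₁z₀ + x₁y₀z₁ + x₀y₁z₁`. -/
def polar2 (x₀ x₁ y₀ y₁ z₀ z₁ : R) : R := x₁ * y₁ * z₀ + x₁ * y₀ * z₁ + x₀ * y₁ * z₁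

/-- The cubic form of `Gc` in its twelve pattern masses (`Gc = GcPoly (P(Q)) (P(PD)) D_o EQbo EQb3
EQb3o EQo EQ3 EQ3o PDb PDbo gap`, `Gc_eq_GcPoly`). -/
def GcPoly (Q PD Do EQbo EQb3 EQb3o EQo EQ3 EQ3o PDb PDbo gap : R) : R :=
  Q * (PD * EQbo + Do * EQb3 - PD * EQb3o) + gap * (PD * EQo + Do * EQ3 - PD * EQ3o) +
    Q * (Do * PDb - PD * PDbo)

/-- The one-copy polarised form of `GcPoly` (three times the Bernstein coefficient `b₁`). -/
def B1Poly (Q₀ PD₀ Do₀ EQbo₀ EQb3₀ EQb3o₀ EQo₀ EQ3₀ EQ3o₀ PDb₀ PDbo₀ gap₀ Q₁ PD₁ Do₁ EQbo₁ EQb3₁ EQb3o₁ EQo₁ EQ3₁ EQ3o₁ PDb₁ PDbo₁ gap₁ : R) : R :=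
  polar1 Q₀ Q₁ PD₀ PD₁ EQbo₀ EQbo₁ +
    polar1 Q₀ Q₁ Do₀ Do₁ EQb3₀ EQb3₁ -
    polar1 Q₀ Q₁ PD₀ PD₁ EQb3o₀ EQb3o₁ +
    polar1 gap₀ gap₁ PD₀ PD₁ EQo₀ EQo₁ +
    polar1 gap₀ gap₁ Do₀ Do₁ EQ3₀ EQ3₁ -
    polar1 gap₀ gap₁ PD₀ PD₁ EQ3o₀ EQ3o₁ +
    polar1 Q₀ Q₁ Do₀ Do₁ PDb₀ PDb₁ -
    polar1 Q₀ Q₁ PD₀ PD₁ PDbo₀ PDbo₁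

/-- The two-copy polarised form of `GcPoly` (three times the Bernstein coefficient `b₂`). -/
def B2Poly (Q₀ PD₀ Do₀ EQbo₀ EQb3₀ EQb3o₀ EQo₀ EQ3₀ EQ3o₀ PDb₀ PDbo₀ gap₀ Q₁ PD₁ Do₁ EQbo₁ EQb3₁ EQb3o₁ EQo₁ EQ3₁ EQ3o₁ PDb₁ PDbo₁ gap₁ : R) : R :=
  polar2 Q₀ Q₁ PD₀ PD₁ EQbo₀ EQbo₁ +
    polar2 Q₀ Q₁ Do₀ Do₁ EQb3₀ EQb3₁ -
    polar2 Q₀ Q₁ PD₀ PD₁ EQb3o₀ EQb3o₁ +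
    polar2 gap₀ gap₁ PD₀ PD₁ EQo₀ EQo₁ +
    polar2 gap₀ gap₁ Do₀ Do₁ EQ3₀ EQ3₁ -
    polar2 gap₀ gap₁ PD₀ PD₁ EQ3o₀ EQ3o₁ +
    polar2 Q₀ Q₁ Do₀ Do₁ PDb₀ PDb₁ -
    polar2 Q₀ Q₁ PD₀ PD₁ PDbo₀ PDbo₁

/-- **The cubic Bernstein expansion of `GcPoly` along a line** `m = t·m₁ + (1 − t)·m₀`:
`GcPoly m = (1 − t)³·GcPoly m₀ + t(1 − t)²·B1Poly + t²(1 − t)·B2Poly + t³·GcPoly m₁`. -/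
lemma GcPoly_pin (t Q₀ PD₀ Do₀ EQbo₀ EQb3₀ EQb3o₀ EQo₀ EQ3₀ EQ3o₀ PDb₀ PDbo₀ gap₀ Q₁ PD₁ Do₁ EQbo₁ EQb3₁ EQb3o₁ EQo₁ EQ3₁ EQ3o₁ PDb₁ PDbo₁ gap₁ : R) :
    GcPoly (t * Q₁ + (1 - t) * Q₀) (t * PD₁ + (1 - t) * PD₀) (t * Do₁ + (1 - t) * Do₀) (t * EQbo₁ + (1 - t) * EQbo₀) (t * EQb3₁ + (1 - t) * EQb3₀) (t * EQb3o₁ + (1 - t) * EQb3o₀) (t * EQo₁ + (1 - t) * EQo₀) (t * EQ3₁ + (1 - t) * EQ3₀) (t * EQ3o₁ + (1 - t) * EQ3o₀) (t * PDb₁ + (1 - t) * PDb₀) (t * PDbo₁ + (1 - t) * PDbo₀) (t * gap₁ + (1 - t) * gap₀) =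
      (1 - t) ^ 3 * GcPoly Q₀ PD₀ Do₀ EQbo₀ EQb3₀ EQb3o₀ EQo₀ EQ3₀ EQ3o₀ PDb₀ PDbo₀ gap₀ + t * (1 - t) ^ 2 * B1Poly Q₀ PD₀ Do₀ EQbo₀ EQb3₀ EQb3o₀ EQo₀ EQ3₀ EQ3o₀ PDb₀ PDbo₀ gap₀ Q₁ PD₁ Do₁ EQbo₁ EQb3₁ EQb3o₁ EQo₁ EQ3₁ EQ3o₁ PDb₁ PDbo₁ gap₁ +
        t ^ 2 * (1 - t) * B2Poly Q₀ PD₀ Do₀ EQbo₀ EQb3₀ EQb3o₀ EQo₀ EQ3₀ EQ3o₀ PDb₀ PDbo₀ gap₀ Q₁ PD₁ Do₁ EQbo₁ EQb3₁ EQb3o₁ EQo₁ EQ3₁ EQ3o₁ PDb₁ PDbo₁ gap₁ + t ^ 3 * GcPoly Q₁ PD₁ Do₁ EQbo₁ EQb3₁ EQb3o₁ EQo₁ EQ3₁ EQ3o₁ PDb₁ PDbo₁ gap₁ := by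
  unfold GcPoly B1Poly B2Poly polar1 polar2
  ring

end Polar

section Cubic

variable {V : Type*} {E : Type*} [Fintype E] [DecidableEq E] {R : Type*} [Field R] [LinearOrder R]

omit [LinearOrder R] in
/-- Pinning of `Do`. -/
lemma Do_pin (p : E → R) (ends : E → Sym2 V) (o a₁ a₂ a₃ : V) (e : E) :
    Do p ends o a₁ a₂ a₃ =
      p e * Do (Function.update p e 1) ends o a₁ a₂ a₃ +
        (1 - p e) * Do (Function.update p e 0) ends o a₁ a₂ a₃ := by
  unfold Do; rw [prob_eq_pin p _ e, prob_eq_pin p _ e]; ring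

omit [LinearOrder R] in
/-- Pinning of `EQbo`. -/
lemma EQbo_pin (p : E → R) (ends : E → Sym2 V) (o a₁ a₂ b : V) (e : E) :
    EQbo p ends o a₁ a₂ b =
      p e * EQbo (Function.update p e 1) ends o a₁ a₂ b +
        (1 - p e) * EQbo (Function.update p e 0) ends o a₁ a₂ b := by
  unfold EQbo
  rw [prob_eq_pin p _ e, prob_eq_pin p _ e, prob_eq_pin p _ e, prob_eq_pin p _ e]; ring

omit [LinearOrder R] in
/-- Pinning of `EQb3`. -/
lemma EQb3_pin (p : E → R) (ends : E → Sym2 V) (a₁ a₂ a₃ b : V) (e : E) :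
    EQb3 p ends a₁ a₂ a₃ b =
      p e * EQb3 (Function.update p e 1) ends a₁ a₂ a₃ b +
        (1 - p e) * EQb3 (Function.update p e 0) ends a₁ a₂ a₃ b := by
  unfold EQb3
  rw [prob_eq_pin p _ e, prob_eq_pin p _ e, prob_eq_pin p _ e, prob_eq_pin p _ e]; ring

omit [LinearOrder R] in
/-- Pinning of `EQb3o`. -/
lemma EQb3o_pin (p : E → R) (ends : E → Sym2 V) (o a₁ a₂ a₃ b : V) (e : E) :
    EQb3o p ends o a₁ a₂ a₃ b =
      p e * EQb3o (Function.update p e 1) ends o a₁ a₂ a₃ b +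
        (1 - p e) * EQb3o (Function.update p e 0) ends o a₁ a₂ a₃ b := by
  unfold EQb3o
  rw [prob_eq_pin p _ e, prob_eq_pin p _ e, prob_eq_pin p _ e, prob_eq_pin p _ e,
    prob_eq_pin p _ e, prob_eq_pin p _ e, prob_eq_pin p _ e, prob_eq_pin p _ e]; ring

omit [LinearOrder R] in
/-- Pinning of `EQo`. -/
lemma EQo_pin (p : E → R) (ends : E → Sym2 V) (o a₁ a₂ : V) (e : E) :
    EQo p ends o a₁ a₂ =
      p e * EQo (Function.update p e 1) ends o a₁ a₂ +
        (1 - p e) * EQo (Function.update p e 0) ends o a₁ a₂ := by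
  unfold EQo; rw [prob_eq_pin p _ e, prob_eq_pin p _ e]; ring

omit [LinearOrder R] in
/-- Pinning of `EQ3`. -/
lemma EQ3_pin (p : E → R) (ends : E → Sym2 V) (a₁ a₂ a₃ : V) (e : E) :
    EQ3 p ends a₁ a₂ a₃ =
      p e * EQ3 (Function.update p e 1) ends a₁ a₂ a₃ +
        (1 - p e) * EQ3 (Function.update p e 0) ends a₁ a₂ a₃ := by
  unfold EQ3; rw [prob_eq_pin p _ e, prob_eq_pin p _ e]; ring

omit [LinearOrder R] in
/-- Pinning of `EQ3o`. -/
lemma EQ3o_pin (p : E → R) (ends : E → Sym2 V) (o a₁ a₂ a₃ : V) (e : E) :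
    EQ3o p ends o a₁ a₂ a₃ =
      p e * EQ3o (Function.update p e 1) ends o a₁ a₂ a₃ +
        (1 - p e) * EQ3o (Function.update p e 0) ends o a₁ a₂ a₃ := by
  unfold EQ3o
  rw [prob_eq_pin p _ e, prob_eq_pin p _ e, prob_eq_pin p _ e, prob_eq_pin p _ e]; ring

omit [LinearOrder R] in
/-- Pinning of `PDb`. -/
lemma PDb_pin (p : E → R) (ends : E → Sym2 V) (a₁ a₂ a₃ b : V) (e : E) :
    PDb p ends a₁ a₂ a₃ b =
      p e * PDb (Function.update p e 1) ends a₁ a₂ a₃ b +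
        (1 - p e) * PDb (Function.update p e 0) ends a₁ a₂ a₃ b := by
  unfold PDb; rw [prob_eq_pin p _ e, prob_eq_pin p _ e]; ring

omit [LinearOrder R] in
/-- Pinning of `PDbo`. -/
lemma PDbo_pin (p : E → R) (ends : E → Sym2 V) (o a₁ a₂ a₃ b : V) (e : E) :
    PDbo p ends o a₁ a₂ a₃ b =
      p e * PDbo (Function.update p e 1) ends o a₁ a₂ a₃ b +
        (1 - p e) * PDbo (Function.update p e 0) ends o a₁ a₂ a₃ b := by
  unfold PDbo
  rw [prob_eq_pin p _ e, prob_eq_pin p _ e, prob_eq_pin p _ e, prob_eq_pin p _ e]; ring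

omit [LinearOrder R] in
/-- Pinning of `gap`. -/
lemma gap_pin (p : E → R) (ends : E → Sym2 V) (a₁ a₂ b : V) (e : E) :
    gap p ends a₁ a₂ b =
      p e * gap (Function.update p e 1) ends a₁ a₂ b +
        (1 - p e) * gap (Function.update p e 0) ends a₁ a₂ b := by
  unfold gap; rw [prob_eq_pin p _ e, prob_eq_pin p _ e]; ring

omit [LinearOrder R] in
/-- `Gc` is `GcPoly` of its twelve pattern masses. -/
lemma Gc_eq_GcPoly (p : E → R) (ends : E → Sym2 V) (o a₁ a₂ a₃ b : V) :
    Gc p ends o a₁ a₂ a₃ b = GcPoly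
      (prob p (avoidAll ends a₂ {a₁})) (prob p (PDEvent ends a₁ a₂ a₃)) (Do p ends o a₁ a₂ a₃)
      (EQbo p ends o a₁ a₂ b) (EQb3 p ends a₁ a₂ a₃ b) (EQb3o p ends o a₁ a₂ a₃ b) (EQo p ends o
      a₁ a₂) (EQ3 p ends a₁ a₂ a₃) (EQ3o p ends o a₁ a₂ a₃) (PDb p ends a₁ a₂ a₃ b) (PDbo p ends
      o a₁ a₂ a₃ b) (gap p ends a₁ a₂ b) := by
  unfold Gc DEF GcPoly
  ring

/-- **The one-copy Bernstein coefficient `B1`** of `Gc` along the edge `e` (three times the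
Bernstein `b₁`): the cubic form of `Gc` with ONE of the three copies at `p[e↦1]` and two at
`p[e↦0]`, summed over the three positions. -/
noncomputable def B1 (p : E → R) (ends : E → Sym2 V) (o a₁ a₂ a₃ b : V) (e : E) : R :=
  B1Poly
    (prob (Function.update p e 0) (avoidAll ends a₂ {a₁})) (prob (Function.update p e 0)
    (PDEvent ends a₁ a₂ a₃)) (Do (Function.update p e 0) ends o a₁ a₂ a₃) (EQbo (Function.update
    p e 0) ends o a₁ a₂ b) (EQb3 (Function.update p e 0) ends a₁ a₂ a₃ b) (EQb3o
    (Function.update p e 0) ends o a₁ a₂ a₃ b) (EQo (Function.update p e 0) ends o a₁ a₂) (EQ3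
    (Function.update p e 0) ends a₁ a₂ a₃) (EQ3o (Function.update p e 0) ends o a₁ a₂ a₃) (PDb
    (Function.update p e 0) ends a₁ a₂ a₃ b) (PDbo (Function.update p e 0) ends o a₁ a₂ a₃ b)
    (gap (Function.update p e 0) ends a₁ a₂ b)
    (prob (Function.update p e 1) (avoidAll ends a₂ {a₁})) (prob (Function.update p e 1)
    (PDEvent ends a₁ a₂ a₃)) (Do (Function.update p e 1) ends o a₁ a₂ a₃) (EQbo (Function.update
    p e 1) ends o a₁ a₂ b) (EQb3 (Function.update p e 1) ends a₁ a₂ a₃ b) (EQb3o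
    (Function.update p e 1) ends o a₁ a₂ a₃ b) (EQo (Function.update p e 1) ends o a₁ a₂) (EQ3
    (Function.update p e 1) ends a₁ a₂ a₃) (EQ3o (Function.update p e 1) ends o a₁ a₂ a₃) (PDb
    (Function.update p e 1) ends a₁ a₂ a₃ b) (PDbo (Function.update p e 1) ends o a₁ a₂ a₃ b)
    (gap (Function.update p e 1) ends a₁ a₂ b)

/-- **The two-copy Bernstein coefficient `B2`** of `Gc` along the edge `e` (three times the
Bernstein `b₂`): two copies at `p[e↦1]`, one at `p[e↦0]`. -/
noncomputable def B2 (p : E → R) (ends : E → Sym2 V) (o a₁ a₂ a₃ b : V) (e : E) : R :=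
  B2Poly
    (prob (Function.update p e 0) (avoidAll ends a₂ {a₁})) (prob (Function.update p e 0)
    (PDEvent ends a₁ a₂ a₃)) (Do (Function.update p e 0) ends o a₁ a₂ a₃) (EQbo (Function.update
    p e 0) ends o a₁ a₂ b) (EQb3 (Function.update p e 0) ends a₁ a₂ a₃ b) (EQb3o
    (Function.update p e 0) ends o a₁ a₂ a₃ b) (EQo (Function.update p e 0) ends o a₁ a₂) (EQ3
    (Function.update p e 0) ends a₁ a₂ a₃) (EQ3o (Function.update p e 0) ends o a₁ a₂ a₃) (PDb
    (Function.update p e 0) ends a₁ a₂ a₃ b) (PDbo (Function.update p e 0) ends o a₁ a₂ a₃ b)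
    (gap (Function.update p e 0) ends a₁ a₂ b)
    (prob (Function.update p e 1) (avoidAll ends a₂ {a₁})) (prob (Function.update p e 1)
    (PDEvent ends a₁ a₂ a₃)) (Do (Function.update p e 1) ends o a₁ a₂ a₃) (EQbo (Function.update
    p e 1) ends o a₁ a₂ b) (EQb3 (Function.update p e 1) ends a₁ a₂ a₃ b) (EQb3o
    (Function.update p e 1) ends o a₁ a₂ a₃ b) (EQo (Function.update p e 1) ends o a₁ a₂) (EQ3
    (Function.update p e 1) ends a₁ a₂ a₃) (EQ3o (Function.update p e 1) ends o a₁ a₂ a₃) (PDb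
    (Function.update p e 1) ends a₁ a₂ a₃ b) (PDbo (Function.update p e 1) ends o a₁ a₂ a₃ b)
    (gap (Function.update p e 1) ends a₁ a₂ b)

omit [LinearOrder R] in
/-- **The one-edge cubic of `Gc` in the Bernstein basis** (any edge `e`, `t = p e`):
`Gc p = (1 − t)³·Gc p[e↦0] + t(1 − t)²·B1 + t²(1 − t)·B2 + t³·Gc p[e↦1]`. -/
theorem Gc_pin_cubic (p : E → R) (ends : E → Sym2 V) (o a₁ a₂ a₃ b : V) (e : E) :
    Gc p ends o a₁ a₂ a₃ b =
      (1 - p e) ^ 3 * Gc (Function.update p e 0) ends o a₁ a₂ a₃ b +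
        p e * (1 - p e) ^ 2 * B1 p ends o a₁ a₂ a₃ b e +
        (p e) ^ 2 * (1 - p e) * B2 p ends o a₁ a₂ a₃ b e +
        (p e) ^ 3 * Gc (Function.update p e 1) ends o a₁ a₂ a₃ b := by
  rw [Gc_eq_GcPoly p, Gc_eq_GcPoly (Function.update p e 0), Gc_eq_GcPoly (Function.update p e 1),
    prob_eq_pin p (avoidAll ends a₂ {a₁}) e, prob_eq_pin p (PDEvent ends a₁ a₂ a₃) e,
    Do_pin p ends o a₁ a₂ a₃ e, EQbo_pin p ends o a₁ a₂ b e, EQb3_pin p ends a₁ a₂ a₃ b e,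
    EQb3o_pin p ends o a₁ a₂ a₃ b e, EQo_pin p ends o a₁ a₂ e, EQ3_pin p ends a₁ a₂ a₃ e,
    EQ3o_pin p ends o a₁ a₂ a₃ e, PDb_pin p ends a₁ a₂ a₃ b e, PDbo_pin p ends o a₁ a₂ a₃ b e,
    gap_pin p ends a₁ a₂ b e]
  exact GcPoly_pin _ _ _ _ _ _ _ _ _ _ _ _ _ _ _ _ _ _ _ _ _ _ _ _ _

end Cubic

section Closure

variable {V : Type*} {E : Type*} [Fintype E] [DecidableEq E] {R : Type*} [Field R] [LinearOrder R]
  [IsStrictOrderedRing R]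

/-- **Closure along an edge from its two Bernstein coefficients**: (HCOV) at `p[e↦0]` and `p[e↦1]`
with `0 ≤ B1` and `0 ≤ B2` give (HCOV) at `p` (row 2′CPOLAR at the edge `e`). -/
theorem HCov_of_update_zero_of_bern (p : E → R) (hp : IsProbVec p) (ends : E → Sym2 V)
    (o a₁ a₂ a₃ b : V) (e : E) (h₀ : HCov (Function.update p e 0) ends o a₁ a₂ a₃ b)
    (h₁ : HCov (Function.update p e 1) ends o a₁ a₂ a₃ b) (hB1 : 0 ≤ B1 p ends o a₁ a₂ a₃ b e)
    (hB2 : 0 ≤ B2 p ends o a₁ a₂ a₃ b e) : HCov p ends o a₁ a₂ a₃ b := by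
  unfold HCov at *
  rw [Gc_pin_cubic p ends o a₁ a₂ a₃ b e]
  have ht := hp.nonneg e
  have ht' : 0 ≤ 1 - p e := by linarith [hp.le_one e]
  refine add_nonneg (add_nonneg (add_nonneg ?_ ?_) ?_) ?_
  · exact mul_nonneg (pow_nonneg ht' 3) h₀
  · exact mul_nonneg (mul_nonneg ht (pow_nonneg ht' 2)) hB1
  · exact mul_nonneg (mul_nonneg (pow_nonneg ht 2) ht') hB2
  · exact mul_nonneg (pow_nonneg ht 3) h₁

end Closure

end EdgeLine

end CovForm

end Summit.Ventures.PercRepro2
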